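import Literature.NumberTheory.LFunctions.WeilTwoPrimeCellsT80Data2
import HarnessLib

/-!
# Two-prime minorant cells on `[0, 80]`: kernel check of cells 191–247

`TPDCell.checkZ 120 5` on cells 191–247 of `weilTwoPrimeCellsT80`, by `decide +kernel`, in its own file for kernel time. Pure proof file; nothing is asserted.
-/

noncomputable section

namespace Literature.NumberTheory.LFunctions

set_option maxHeartbeats 0 in
/-- **Kernel check of cells 191–247** of the two-prime minorant on `[0, 80]`. [folklore] -/
theorem checkCells_weilTwoPrimeCellsT80C2 :
    (weilTwoPrimeCellsT80C2.all fun c ↦ c.checkZ 120 5) = true := by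
  decide +kernel

end Literature.NumberTheory.LFunctions
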